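/-
Origin: expansion seat `planner-pub-hodgecm-pv07-g5-0`, handover #4 2026-08-18T12:57:19Z (md5 a08cff8b607ab9df8b4627c53dc8a60d; NEW additive leaf; TWO import rewrites by the generic rule: Pv07g5.GenuineCoeffInput (my #3), Pv07g4.GenuineSchrodingerShift (RUN-29 row 44deaca5, landed); land AFTER my #3; my #5 imports it) (`HOME/pub-hodgecm-pv07-g5/lean/Pv07g5/GenuineSchrodingerSubEmbed.lean`, md5 a08cff8b, 176 lines);
landed by the gen-8 packager in gate run 30 as `HodgeCM/PerL34/GenuineSchrodingerSubEmbed.lean` (import ^import Pv07g5\.GenuineCoeffInput[ \t]*$→import HodgeCM.PerL34.GenuineCoeffInput ×1; import ^import Pv07g4\.GenuineSchrodingerShift[ \t]*$→import HodgeCM.PerL34.GenuineSchrodingerShift ×1).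
-/
/-
Copyright: HodgeCM publication cell (pub-hodgecm), DAG node N31 (seam S3, PerL v5 Lemma 4.2(b)) — the S3 END with the
torus side discharged by the genuine split Schrödinger model through an equivariant isometric embedding of a STABLE
SUBSPACE containing the model vector (e.g. its cyclic subspace), at coefficient level.
Prover seat pub-hodgecm-pv07-g5 (DAG-node prover #07, generation 5), file #4 (HANDOVER #4).  Released under the
package licence.

Imports this seat's file #3 (`GenuineCoeffInput`, HANDOVER #3; in the tree `HodgeCM.PerL34.GenuineCoeffInput`) and
pv07-g4's `GenuineSchrodingerShift` (handed for RUN 29; in the tree `HodgeCM.PerL34.GenuineSchrodingerShift`).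
Complete proofs, no new axioms, nothing cited, no hypothesis posited.
-/
import Summits.HodgeConjecture.HodgeCM.PerL34.GenuineCoeffInput_2
import Summits.HodgeConjecture.HodgeCM.PerL34.GenuineSchrodingerShift_2

/-!
# Lemma 4.2(b), torus side by the genuine Schrödinger model, along an embedding of a stable subspace

File #2 of this seat (`GenuineSchrodingerEmbed`) feeds the S3 END of a doubling datum `D` on any space `Sp` through an
isometric equivariant embedding `E : L²(X) →ₗᵢ[ℂ] Sp` of the WHOLE model space `L²(X)`
(`X = ⊔_{v split} (L⁺_v)³`, pv07-g4).  A genuine adelic theta datum lives on Schwartz–Bruhat functions and cannot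
contain an isometric copy of `L²(X)`; but the END reads the torus side only through matrix coefficients of the one
vector `φ_e` (file #3, `GenuineCoeffInput`), and those are seen on ANY stable subspace `V ∋ φ_e` of `L²(X)` — for
instance the cyclic subspace `Transfer.cyclicSpan`, whose elements are finite combinations of twisted dilates of
`φ_e = (⊗_{v ∉ S} 1_{𝒪_v³}) ⊗ (⊗_{v ∈ S} (shifted ball indicators))`, i.e. Schwartz–Bruhat functions on `X`.

* `coeffInputShift`: the coefficient-level input of the shifted twisted model (from pv07-g4's `torusSideShift` through
  `GenuineThetaInput.toCoeffInput`);
* **`exists_compactDomain_thetaLift_ne_zero_genuine_subEmbed`**: the END for `D` on any `Sp` (+ theta side, print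
  inputs, `hloc`, the `χ`-side level data — unchanged), a stable submodule `V` of `L²(X)` containing `φ_e`, and an
  isometric embedding `E : V →ₗᵢ[ℂ] Sp` equivariant for the restricted representation; conclusion for `E ⟨φ_e, _⟩`;
* **`exists_compactDomain_thetaLift_ne_zero_genuine_cyclicEmbed`**: the case `V := cyclicSpan (rep L (twistChar L χ)) φ_e`.

ABSOLUTE RULE respected: nothing cited; all hypotheses are data, hypotheses of pv09-g5's END passed through unchanged,
or the equivariance equation `hE`.
-/

set_option linter.unusedSectionVars false

noncomputable section

open MeasureTheory MeasureTheory.Measure Set Metric Function Complex ComplexConjugate Topology Filter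
open scoped RestrictedProduct InnerProductSpace NNReal ENNReal TensorProduct

namespace HodgeCM.PerL34.PureTensor

open HodgeCM.PerL34.SplitShells HodgeCM.PerL34.AdelicFactorisation HodgeCM.PerL34.RestrictedMeasure
open HodgeCM.PerL34.NoSmallSubgroups HodgeCM.PerL34.EulerFactorisation HodgeCM.PerL34.DiscreteFD
open HodgeCM.PerL34.LocalFactors HodgeCM.PerL34.LocalFactors.DilationModel
open HodgeCM.PerL34.LocalModulus HodgeCM.PerL34.SplitPlaceDilation
open HodgeCM.PerL34.RallisIP HodgeCM.PerL34.Doubling HodgeCM.PerL34.N31d NumberField IsDedekindDomain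
open HodgeCM.PerL34.IdelePlaces HodgeCM.PerL34.RestrictedRegroup HodgeCM.PerL34.RestrictedCutout
open HodgeCM.PerL34.IdelicTorusModel HodgeCM.PerL34.IdelicTorusModel.Genuine

attribute [local instance] LocalFactors.DilationModel.Adic.nontriviallyNormedField
  LocalFactors.DilationModel.Adic.properSpace

namespace SchrodingerModel

namespace Coeff

variable (L : Type) [Field L] [NumberField L] [IsCMField L]

local notation3 "L⁺" => maximalRealSubfield L

/-- **The coefficient-level S3 input of the shifted twisted genuine split Schrödinger model** at `S ⊇ T'`
(pv07-g4 `torusSideShift`, through `GenuineThetaInput.toCoeffInput`). -/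
def coeffInputShift [DecidableEq (Place L⁺)]
    [∀ v : HeightOneSpectrum (𝓞 L⁺), MeasurableSpace (v.adicCompletion L⁺)]
    [∀ v : HeightOneSpectrum (𝓞 L⁺), BorelSpace (v.adicCompletion L⁺)]
    (S : Finset (Place L⁺)) (χ : Model L →* Circle) {T' : Finset (Place L⁺)}
    (hχT' : RestrictedProduct.boxSubgroup (genLevel L) T' ≤ χ.ker)
    (hlocχ : ∀ i ∈ T', Continuous fun g : locTorus L⁺ L i => χ (RestrictedProduct.mulSingle (genLevel L) i g))
    (hT'S : T' ⊆ S) :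
    GenuineCoeffInput L S (Lp ℂ 2 (μ L)) (rep L (twistChar L χ)) (phiE (shiftFor S χ hχT' hlocχ)) χ :=
  (Classical.choice (torusSideShift S χ hχT' hlocχ hT'S).1).toCoeffInput (torusSideShift S χ hχT' hlocχ hT'S).2.1

section subEmbed

-- (no `L⁺` notation inside `variable` binders: a `notation3` token there does not re-elaborate)

variable [DecidableEq (Place (maximalRealSubfield L))]
    [∀ v : HeightOneSpectrum (𝓞 (maximalRealSubfield L)), MeasurableSpace (v.adicCompletion (maximalRealSubfield L))]
    [∀ v : HeightOneSpectrum (𝓞 (maximalRealSubfield L)), BorelSpace (v.adicCompletion (maximalRealSubfield L))]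
    (S₀ : Finset (Place (maximalRealSubfield L)))
    {Sp : Type} [NormedAddCommGroup Sp] [InnerProductSpace ℂ Sp]
    {W : Type} [AddCommGroup W] [Module L W]
    {H Sbox : Type} [Group H] [AddCommGroup Sbox] [Module ℂ Sbox]
    {h : W →ₗ⋆[L] W →ₗ[L] L} (hW : IsLine L W) (hh : Anisotropic h)
    (D : DoublingDatum (Model L) H Sp Sbox) (GU : ThetaSide Sp Sbox)
    (j : isomBox h →* H) (hj : ∀ d : unitary L, j ⟨iotaSnd d, iotaSnd_mem h d⟩ = D.ι (1, unitaryToModel L d))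
    (χ : Model L →* Circle) (hχΓ : ∀ d : unitary L, χ (unitaryToModel L d) = 1)
    (hχVΓ : ∀ d : unitary L, D.χV (unitaryToModel L d) = 1)
    {hP : ∀ Ψ : Sbox, ∀ p ∈ (stabDelta L W).subgroupOf (isomBox h), ∀ x : H, D.fSW Ψ (j p * x) = D.fSW Ψ x}
    (P : GluePrintInputs D GU h j hP)
    (hloc : ∀ (i : Place (maximalRealSubfield L)) (v : Sp),
      Continuous fun g : locTorus (maximalRealSubfield L) L i => D.ω (RestrictedProduct.mulSingle (genLevel L) i g) v)
    {T' : Finset (Place (maximalRealSubfield L))} (hχT' : RestrictedProduct.boxSubgroup (genLevel L) T' ≤ χ.ker)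
    (hlocχ : ∀ i ∈ T', Continuous fun g : locTorus (maximalRealSubfield L) L i => χ (RestrictedProduct.mulSingle (genLevel L) i g))
    {S : Finset (Place (maximalRealSubfield L))} (hT'S : T' ⊆ S) (hS : ∀ v : InfinitePlace (maximalRealSubfield L), Sum.inl v ∈ S)

include hW hh hj hχΓ hχVΓ P hloc hT'S hS

set_option synthInstance.maxHeartbeats 200000 in
-- (as in the END theorem: the `SMul Γ (Model L)` instance behind `IsFundamentalDomain` is slow to find)
/-- **S3 END, torus side by the genuine split Schrödinger model ALONG AN EMBEDDING OF A STABLE SUBSPACE.**  For a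
doubling datum `D` on ANY space `Sp` (+ theta side `GU`, print inputs `P`, strong continuity `hloc`, the `χ`-side level
data — all unchanged), a submodule `V` of the model space `L²(X)` stable under `rep L (twistChar L χ)` and containing
the model vector `φ_e = phiE (shiftFor S χ hχT' hlocχ)`, and an isometric embedding `E : V →ₗᵢ[ℂ] Sp` equivariant
for the restricted representation: the END's conclusion for the vector `E ⟨φ_e, _⟩`. -/
theorem exists_compactDomain_thetaLift_ne_zero_genuine_subEmbed
    (V : Submodule ℂ (Lp ℂ 2 (μ L))) (hV : ∀ (g : Model L) (v : Lp ℂ 2 (μ L)), v ∈ V → rep L (twistChar L χ) g v ∈ V)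
    (hφV : phiE (shiftFor S χ hχT' hlocχ) ∈ V)
    (E : V →ₗᵢ[ℂ] Sp)
    (hE : ∀ (g : Model L) (v : V), E (Transfer.restrict (rep L (twistChar L χ)) V hV g v) = D.ω g (E v))
    [IsFiniteMeasure GU.μ] :
    ∃ 𝓕 : Set (Model L), IsCompact 𝓕 ∧ (interior 𝓕).Nonempty ∧ MeasurableSet 𝓕 ∧
      IsFundamentalDomain (unitaryToModel L).range 𝓕
        (haarDatum (genLevel L) (isCompact_genLevel L) (isOpen_genLevel L) S₀).μ ∧
      (haarDatum (genLevel L) (isCompact_genLevel L) (isOpen_genLevel L) S₀).μ 𝓕 ≠ 0 ∧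
      (haarDatum (genLevel L) (isCompact_genLevel L) (isOpen_genLevel L) S₀).μ 𝓕 ≠ ⊤ ∧
      ∀ [IsFiniteMeasure (((haarDatum (genLevel L) (isCompact_genLevel L) (isOpen_genLevel L) S₀).μ).restrict 𝓕)]
        (hk : Measurable (Function.uncurry (thetaFn D GU (E ⟨phiE (shiftFor S χ hχT' hlocχ), hφV⟩)))) {Ck : ℝ}
        (hCk : 0 ≤ Ck) (hkC : ∀ q u, ‖thetaFn D GU (E ⟨phiE (shiftFor S χ hχT' hlocχ), hφV⟩) q u‖ ≤ Ck),
        PeterssonFubini.theta GU.μ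
          (((haarDatum (genLevel L) (isCompact_genLevel L) (isOpen_genLevel L) S₀).μ).restrict 𝓕) hk
          (measurable_coe_char (genLevel L) (isOpen_genLevel L) χ hχT' hlocχ) hCk hkC (norm_coe_char_le χ) ≠ 0 := by
  obtain ⟨-, hφ, -, hK, hM⟩ := torusSideShift S χ hχT' hlocχ hT'S
  -- the torus model `(V, ω|_V, ⟨φ_e, _⟩)`: every torus-side binder PULLED BACK along the equivariant inclusion `V ↪ L²(X)`
  have hι := Transfer.subtype_restrict (rep L (twistChar L χ)) V hV
  exact exists_compactDomain_thetaLift_ne_zero_genuine_of_coeffEmbedding L S₀ hW hh D GU j hj χ hχΓ hχVΓ P hloc hχT'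
    hlocχ (Transfer.restrict (rep L (twistChar L χ)) V hV) ⟨phiE (shiftFor S χ hχT' hlocχ), hφV⟩ hφ
    (Transfer.fixed_of_mem_of_map (Transfer.restrict (rep L (twistChar L χ)) V hV) (rep L (twistChar L χ))
      V.subtypeₗᵢ hι hK)
    (Transfer.prodFormula_of_map (genLevel L) (Transfer.restrict (rep L (twistChar L χ)) V hV) (rep L (twistChar L χ))
      V.subtypeₗᵢ hι _ hM)
    subset_rfl hT'S hS
    (GenuineCoeffInput.comap V.subtypeₗᵢ hι (coeffInputShift L S χ hχT' hlocχ hT'S)) E hE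

set_option synthInstance.maxHeartbeats 200000 in
-- (as above)
/-- **S3 END, torus side by the genuine split Schrödinger model ALONG AN EMBEDDING OF THE CYCLIC SUBSPACE of
`φ_e`** (`V := Transfer.cyclicSpan (rep L (twistChar L χ)) φ_e`: finite combinations of twisted dilates of `φ_e`). -/
theorem exists_compactDomain_thetaLift_ne_zero_genuine_cyclicEmbed
    (E : Transfer.cyclicSpan (rep L (twistChar L χ)) (phiE (shiftFor S χ hχT' hlocχ)) →ₗᵢ[ℂ] Sp)
    (hE : ∀ (g : Model L) (v : Transfer.cyclicSpan (rep L (twistChar L χ)) (phiE (shiftFor S χ hχT' hlocχ))),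
      E (Transfer.restrict (rep L (twistChar L χ)) _
        (Transfer.cyclicSpan_stable (rep L (twistChar L χ)) (phiE (shiftFor S χ hχT' hlocχ))) g v) = D.ω g (E v))
    [IsFiniteMeasure GU.μ] :
    ∃ 𝓕 : Set (Model L), IsCompact 𝓕 ∧ (interior 𝓕).Nonempty ∧ MeasurableSet 𝓕 ∧
      IsFundamentalDomain (unitaryToModel L).range 𝓕
        (haarDatum (genLevel L) (isCompact_genLevel L) (isOpen_genLevel L) S₀).μ ∧
      (haarDatum (genLevel L) (isCompact_genLevel L) (isOpen_genLevel L) S₀).μ 𝓕 ≠ 0 ∧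
      (haarDatum (genLevel L) (isCompact_genLevel L) (isOpen_genLevel L) S₀).μ 𝓕 ≠ ⊤ ∧
      ∀ [IsFiniteMeasure (((haarDatum (genLevel L) (isCompact_genLevel L) (isOpen_genLevel L) S₀).μ).restrict 𝓕)]
        (hk : Measurable (Function.uncurry (thetaFn D GU
          (E ⟨phiE (shiftFor S χ hχT' hlocχ),
            Transfer.mem_cyclicSpan_self (rep L (twistChar L χ)) (phiE (shiftFor S χ hχT' hlocχ))⟩)))) {Ck : ℝ}
        (hCk : 0 ≤ Ck) (hkC : ∀ q u, ‖thetaFn D GU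
          (E ⟨phiE (shiftFor S χ hχT' hlocχ),
            Transfer.mem_cyclicSpan_self (rep L (twistChar L χ)) (phiE (shiftFor S χ hχT' hlocχ))⟩) q u‖ ≤ Ck),
        PeterssonFubini.theta GU.μ
          (((haarDatum (genLevel L) (isCompact_genLevel L) (isOpen_genLevel L) S₀).μ).restrict 𝓕) hk
          (measurable_coe_char (genLevel L) (isOpen_genLevel L) χ hχT' hlocχ) hCk hkC (norm_coe_char_le χ) ≠ 0 :=
  exists_compactDomain_thetaLift_ne_zero_genuine_subEmbed L S₀ hW hh D GU j hj χ hχΓ hχVΓ P hloc hχT' hlocχ hT'S hS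
    _ (Transfer.cyclicSpan_stable (rep L (twistChar L χ)) (phiE (shiftFor S χ hχT' hlocχ)))
    (Transfer.mem_cyclicSpan_self (rep L (twistChar L χ)) (phiE (shiftFor S χ hχT' hlocχ))) E hE

end subEmbed

end Coeff

end SchrodingerModel

end HodgeCM.PerL34.PureTensor

end
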